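import Summits.FinalStateConjecture.FinalStateConjecture.Theorems.UniformPhotonSphereChannels.Negative.CommutedField
import Summits.FinalStateConjecture.FinalStateConjecture.Theorems.PhotonSphereChannelsEnergyConservation

/-!
# Crux `UniformPhotonSphereChannels` (K1), negative side — cut-offs, bump data, zero regions
# and localisation of energy integrals

Support file of the standing disprover of item stmt-FinalStateConjecture-10045: the elementary
objects and bookkeeping lemmas used by the assembly of the refutation.

* `exists_cutoff`: a universal constant `C₀ > 0` such that for all `a < b` there is a `C¹`
  cut-off `χ` with `0 ≤ χ ≤ 1`, `χ = 1` on `(−∞, a]`, `χ = 0` on `[b, ∞)`, `|χ′| ≤ C₀/(b − a)`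
  (from `Real.smoothTransition`);
* `exists_bump`: smooth compactly supported data `= 1` on the middle half of a given interval and
  `= 0` off its interior (from `ContDiffBump`);
* vanishing of the energy densities `e`, `e₁` of the pinning files at points near which `u ≡ 0`,
  and the open zero regions `{X + |T| < X_l}`, `{X_r < X − |T|}`;
* localisation of interval integrals of functions vanishing off a sub-interval, and the passage
  from `∫⁻` over a half-line to an interval integral. [folklore]
-/

namespace Summit.FinalStateConjecture.FinalStateConjecture.Theorems

open Set Filter Topology MeasureTheory intervalIntegral

noncomputable section

namespace WaveDefect

open WaveEnergy

/-! ### Cut-offs and bumps -/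

/-- **Cut-offs with controlled slope.**  There is `C₀ > 0` such that for all `a < b` some
`χ ∈ C¹(ℝ)` satisfies `0 ≤ χ ≤ 1`, `χ = 1` on `(−∞, a]`, `χ = 0` on `[b, ∞)` and
`|χ′| ≤ C₀/(b − a)`. -/
theorem exists_cutoff : ∃ C₀ : ℝ, 0 < C₀ ∧ ∀ a b : ℝ, a < b → ∃ χ : ℝ → ℝ, ContDiff ℝ 1 χ ∧
    (∀ X, 0 ≤ χ X ∧ χ X ≤ 1) ∧ (∀ X, X ≤ a → χ X = 1) ∧ (∀ X, b ≤ X → χ X = 0) ∧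
    ∀ X, |deriv χ X| ≤ C₀ / (b - a) := by
  set S : ℝ → ℝ := Real.smoothTransition with hS
  have hSd : ContDiff ℝ 1 S := Real.smoothTransition.contDiff (n := 1)
  have hS'c : Continuous (deriv S) := hSd.continuous_deriv le_rfl
  -- a global bound for `S'`: compactness on `[0, 1]`, zero outside
  obtain ⟨K, hK⟩ := (isCompact_Icc (a := (0 : ℝ)) (b := 1)).exists_bound_of_continuousOn
    hS'c.continuousOn
  have hS'0 : ∀ x, x ∉ Icc (0 : ℝ) 1 → deriv S x = 0 := by
    intro x hx
    rcases lt_or_gt_of_ne (show x ≠ 0 from fun h => hx (by rw [h]; exact ⟨le_rfl, zero_le_one⟩))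
      with h0 | h0
    · have hev : S =ᶠ[𝓝 x] fun _ => (0 : ℝ) := by
        filter_upwards [Iio_mem_nhds h0] with y hy
        exact Real.smoothTransition.zero_of_nonpos (le_of_lt hy)
      rw [hev.deriv_eq, deriv_const]
    · have h1 : 1 < x := by
        by_contra h; push Not at h
        exact hx ⟨h0.le, h⟩
      have hev : S =ᶠ[𝓝 x] fun _ => (1 : ℝ) := by
        filter_upwards [Ioi_mem_nhds h1] with y hy
        exact Real.smoothTransition.one_of_one_le (le_of_lt hy)
      rw [hev.deriv_eq, deriv_const]
  set C₀ : ℝ := max K 1 with hC₀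
  have hC₀pos : 0 < C₀ := lt_of_lt_of_le zero_lt_one (le_max_right _ _)
  have hS'b : ∀ x, |deriv S x| ≤ C₀ := by
    intro x
    by_cases hx : x ∈ Icc (0 : ℝ) 1
    · exact ((Real.norm_eq_abs _).symm.le.trans (hK x hx)).trans (le_max_left _ _)
    · rw [hS'0 x hx, abs_zero]; exact hC₀pos.le
  refine ⟨C₀, hC₀pos, fun a b hab => ?_⟩
  have hba : 0 < b - a := sub_pos.mpr hab
  set χ : ℝ → ℝ := fun X => 1 - S ((X - a) / (b - a)) with hχ
  have hlin : ∀ X, HasDerivAt (fun X => (X - a) / (b - a)) (1 / (b - a)) X := fun X => by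
    simpa using ((hasDerivAt_id X).sub_const a).div_const (b - a)
  have hSd' : ∀ y, HasDerivAt S (deriv S y) y := fun y =>
    ((hSd.differentiable one_ne_zero) y).hasDerivAt
  have hχd : ∀ X, HasDerivAt χ (-(deriv S ((X - a) / (b - a)) * (1 / (b - a)))) X := by
    intro X
    have h := (hSd' ((X - a) / (b - a))).comp X (hlin X)
    have h2 := (hasDerivAt_const X (1 : ℝ)).sub h
    rw [zero_sub] at h2
    exact h2
  refine ⟨χ, ?_, ?_, ?_, ?_, ?_⟩
  · exact contDiff_const.sub (hSd.comp ((contDiff_id.sub contDiff_const).div_const _))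
  · intro X
    exact ⟨sub_nonneg.mpr (Real.smoothTransition.le_one _),
      sub_le_self _ (Real.smoothTransition.nonneg _)⟩
  · intro X hX
    have : (X - a) / (b - a) ≤ 0 := div_nonpos_of_nonpos_of_nonneg (by linarith) hba.le
    simp only [hχ, hS, Real.smoothTransition.zero_of_nonpos this, sub_zero]
  · intro X hX
    have : 1 ≤ (X - a) / (b - a) := by rw [le_div_iff₀ hba]; linarith
    simp only [hχ, hS, Real.smoothTransition.one_of_one_le this, sub_self]
  · intro X
    rw [(hχd X).deriv, abs_neg, abs_mul, abs_of_pos (by positivity : (0 : ℝ) < 1 / (b - a)),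
      mul_one_div]
    exact div_le_div_of_nonneg_right (hS'b _) hba.le

/-- **Smooth bump data.**  For `R > 0` there is `g ∈ C^∞_c(ℝ)` with `g = 1` on
`[c − R/2, c + R/2]` and `g = 0` off `(c − R, c + R)`. -/
theorem exists_bump (c : ℝ) {R : ℝ} (hR : 0 < R) : ∃ g : ℝ → ℝ, ContDiff ℝ 3 g ∧
    HasCompactSupport g ∧ (∀ x, x ∉ Ioo (c - R) (c + R) → g x = 0) ∧
    (∀ x, x ∈ Icc (c - R / 2) (c + R / 2) → g x = 1) := by
  let f : ContDiffBump c := ⟨R / 2, R, by positivity, by linarith⟩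
  refine ⟨f, f.contDiff (n := 3), f.hasCompactSupport, ?_, ?_⟩
  · intro x hx
    apply f.zero_of_le_dist
    show R ≤ dist x c
    rw [Real.dist_eq]
    by_contra h; push Not at h
    rw [abs_lt] at h
    exact hx ⟨by linarith [h.1], by linarith [h.2]⟩
  · intro x hx
    apply f.one_of_mem_closedBall
    show x ∈ Metric.closedBall c (R / 2)
    rw [Metric.mem_closedBall, Real.dist_eq, abs_le]
    exact ⟨by linarith [hx.1], by linarith [hx.2]⟩

/-! ### Zero regions and vanishing of the energy densities -/

variable {u W : ℝ × ℝ → ℝ}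

/-- The left zero region `{X + |T| < X_l}` is open: `u ≡ 0` near each of its points. -/
theorem eventuallyEq_zero_of_zeroL {Xl : ℝ} (hzeroL : ∀ z : ℝ × ℝ, z.2 + |z.1| < Xl → u z = 0)
    {z : ℝ × ℝ} (hz : z.2 + |z.1| < Xl) : u =ᶠ[𝓝 z] fun _ => 0 := by
  have ho : IsOpen {w : ℝ × ℝ | w.2 + |w.1| < Xl} := isOpen_lt (by fun_prop) continuous_const
  filter_upwards [ho.mem_nhds hz] with w hw
  exact hzeroL w hw

/-- The right zero region `{X_r < X − |T|}` is open: `u ≡ 0` near each of its points. -/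
theorem eventuallyEq_zero_of_zeroR {Xr : ℝ} (hzeroR : ∀ z : ℝ × ℝ, Xr < z.2 - |z.1| → u z = 0)
    {z : ℝ × ℝ} (hz : Xr < z.2 - |z.1|) : u =ᶠ[𝓝 z] fun _ => 0 := by
  have ho : IsOpen {w : ℝ × ℝ | Xr < w.2 - |w.1|} := isOpen_lt continuous_const (by fun_prop)
  filter_upwards [ho.mem_nhds hz] with w hw
  exact hzeroR w hw

/-- The energy density vanishes at points near which `u ≡ 0`. -/
theorem energyDensity_eq_zero_of_eventuallyEq {e : ℝ × ℝ → ℝ}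
    (he : ∀ z, e z = (fderiv ℝ u z (1, 0)) ^ 2 + (fderiv ℝ u z (0, 1)) ^ 2 + W z * u z ^ 2)
    {z : ℝ × ℝ} (hz : u =ᶠ[𝓝 z] fun _ => 0) : e z = 0 := by
  rw [he, fderiv_eq_zero_of_eventuallyEq_zero hz, hz.self_of_nhds]
  simp

/-- The commuted energy density vanishes at points near which `u ≡ 0`. -/
theorem commutedDensity_eq_zero_of_eventuallyEq {e₁ : ℝ × ℝ → ℝ}
    (he₁ : ∀ z, e₁ z = (fderiv ℝ (fun w => fderiv ℝ u w (0, 1)) z (1, 0)) ^ 2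
      + (fderiv ℝ (fun w => fderiv ℝ u w (0, 1)) z (0, 1)) ^ 2
      + W z * (fderiv ℝ u z (0, 1)) ^ 2)
    {z : ℝ × ℝ} (hz : u =ᶠ[𝓝 z] fun _ => 0) : e₁ z = 0 := by
  have hv : (fun w => fderiv ℝ u w (0, 1)) =ᶠ[𝓝 z] fun _ => 0 := by
    filter_upwards [hz.eventually_nhds] with w hw
    rw [fderiv_eq_zero_of_eventuallyEq_zero hw]; rfl
  rw [he₁, fderiv_eq_zero_of_eventuallyEq_zero hv, fderiv_eq_zero_of_eventuallyEq_zero hz]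
  simp

/-! ### Localisation of integrals -/

/-- An interval integral of a continuous function vanishing on `[a, c]` and on `[d, b]`
(`a ≤ c`, `d ≤ b`) is the integral over `[c, d]`. -/
theorem intervalIntegral_eq_of_eq_zero {f : ℝ → ℝ} (hf : Continuous f) {a b c d : ℝ}
    (hac : a ≤ c) (hdb : d ≤ b)
    (h1 : ∀ x ∈ Icc a c, f x = 0) (h2 : ∀ x ∈ Icc d b, f x = 0) :
    ∫ x in a..b, f x = ∫ x in c..d, f x := by
  have hi : ∀ p q : ℝ, IntervalIntegrable f volume p q := fun p q => hf.intervalIntegrable p q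
  rw [← intervalIntegral.integral_add_adjacent_intervals (hi a c) (hi c b),
    ← intervalIntegral.integral_add_adjacent_intervals (hi c d) (hi d b)]
  have e1 : ∫ x in a..c, f x = 0 := by
    rw [← intervalIntegral.integral_zero (a := a) (b := c)]
    exact intervalIntegral.integral_congr fun x hx => h1 x (by rwa [uIcc_of_le hac] at hx)
  have e2 : ∫ x in d..b, f x = 0 := by
    rw [← intervalIntegral.integral_zero (a := d) (b := b)]
    exact intervalIntegral.integral_congr fun x hx => h2 x (by rwa [uIcc_of_le hdb] at hx)
  rw [e1, e2]; ring

/-- An interval integral of a non-negative continuous function over a sub-interval is at most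
the integral over the interval. -/
theorem intervalIntegral_mono_of_nonneg {f : ℝ → ℝ} (hf : Continuous f) (hf0 : ∀ x, 0 ≤ f x)
    {a b c d : ℝ} (hca : c ≤ a) (hab : a ≤ b) (hbd : b ≤ d) :
    ∫ x in a..b, f x ≤ ∫ x in c..d, f x :=
  intervalIntegral.integral_mono_interval hca hab hbd
    (Eventually.of_forall fun x => hf0 x) (hf.intervalIntegrable _ _)

/-- `∫⁻` over a left half-line of a non-negative continuous function vanishing on `(−∞, a]`
is the interval integral over `[a, b]`. -/
theorem lintegral_Iio_eq_of_eq_zero {f : ℝ → ℝ} (hf : Continuous f) (hf0 : ∀ x, 0 ≤ f x)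
    {a b : ℝ} (hab : a ≤ b) (hzero : ∀ x, x ≤ a → f x = 0) :
    ∫⁻ x in Iio b, ENNReal.ofReal (f x) = ENNReal.ofReal (∫ x in a..b, f x) := by
  rw [setLIntegral_congr (Iio_ae_eq_Iic (μ := volume) (a := b)), ← Iic_union_Ioc_eq_Iic hab,
    lintegral_union measurableSet_Ioc (Iic_disjoint_Ioc le_rfl)]
  have h0 : ∫⁻ x in Iic a, ENNReal.ofReal (f x) = 0 := by
    rw [setLIntegral_congr_fun measurableSet_Iic
      (fun x hx => by rw [hzero x hx, ENNReal.ofReal_zero] : EqOn _ (fun _ => (0 : ENNReal)) _)]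
    exact lintegral_zero
  rw [h0, zero_add, lintegral_Ioc_eq_ofReal_intervalIntegral hf hf0 hab]

/-- `∫⁻` over a right half-line of a function vanishing there is zero. -/
theorem lintegral_Ioi_eq_zero_of_eq_zero {f : ℝ → ℝ} {a : ℝ} (hzero : ∀ x, a < x → f x = 0) :
    ∫⁻ x in Ioi a, ENNReal.ofReal (f x) = 0 := by
  rw [setLIntegral_congr_fun measurableSet_Ioi
    (fun x hx => by rw [hzero x hx, ENNReal.ofReal_zero] : EqOn _ (fun _ => (0 : ENNReal)) _)]
  exact lintegral_zero

end WaveDefect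

end

end Summit.FinalStateConjecture.FinalStateConjecture.Theorems
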